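import Summits.QuantumFields.BalabanUV.Beta.EriceRemainderEnclosureHistoryAutonomyComparisonDefectInfiniteMemoryStep

/-!
# EriceRemainderEnclosureHistoryAutonomyComparisonDefectInfiniteMemory — (E140n) **INFINITE MEMORY: the K-free enclosure of a sign-free `ε`-remainder holds for functionals
# with an INFINITE fading history** — window level-Lipschitz profiles with uniformly bounded partial age moments (`Σ_{k<K} kΛ_k ≤ θ < 1`, `Σ_{k<K} Λ_k·k(k+1)∕2 ≤ θ₂` for
# all `K`) and fading tails (`|B u − B v| ≤ η_K` when `u, v` agree on the first `K` coordinates, `η_K → 0`); NO `Finset.range K` memory in the hypotheses, no `tsum`.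
# RESULT (`enclosure_infinite`): `|B′ − B| ≤ ε` ⟹ **`1∕h₋_j² − θ₂·(2ε + θ·2ε∕(1−θ)) ≤ 1∕h′_j² ≤ 1∕h₊_j² + θ₂·(2ε + θ·2ε∕(1−θ))`** at every `j`, `h₋, h₊` the orbits of `B ∓ ε`.
# PROOF: the step file's `step_both` at every truncation level `K` with `η_K ≤ b − b₀ − ε` (eventually), the monotonicity of the constant in the partial moments
# (`const_mono`), and `K → ∞` at fixed `j` by `le_of_tendsto` ∕ `ge_of_tendsto` (the error `(2j + 2κ)η_K` is linear in `η_K`).  Census item (δ)∕(δ′) «K = ∞» of the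
# comparison column CLOSED for the enclosure.

Cell `pub-balaban`, β-function sub-cell, BINDER row D4 «RemainderConst leaves for Bałaban's split» (`HOME/BINDER-OWNERS.md`; owner lineage `b2b-balaban-beta-an4`;
this file by co-owner #2 lineage `b2b-balaban-beta-d4-p2`, generation 108), β-FLOW TEAM duty (1), FREEZE (0) honoured (def-free; `step_both`, `const_mono` BY NAME; nothing
restated).

HONEST FRAMING (page 1, verbatim and binding).  *"Discharging BetaPertH makes Bałaban's UV stability UNCONDITIONAL — a real constructive-QFT result; it is
NOT the continuum limit and NOT the Clay problem."*  THIS FILE DISCHARGES NOTHING OF THE KIND.  Elementary real analysis about ABSTRACT functionals on a box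
]0,γ]^ℕ — hypotheses of a census, not facts: whether Bałaban's (1.22) limit functional has window profiles with bounded age moments and fading tails is NOT PRINTED
([I] p. 298; GAPS G-t4-U2-1∕-2) and NOT asserted.  Row D4 class UNCHANGED (critical-path width 0; instance 0∕1; D4 DISCHARGE NO DATE).  NOT B12 Thm 2, NOT BetaPertH,
NOT continuum YM, NOT Clay.

WHAT IS PROVED ([folklore]; 0 `def`, 0 sorry).  **`enclosure_infinite`**.
-/

noncomputable section
open Finset Set Filter Topology

namespace Summit.QuantumFields.BalabanUV.Beta.EriceRemainderEnclosureHistoryAutonomyComparisonDefectInfiniteMemory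

open Literature.MathematicalPhysics.QuantumFieldTheory.Balaban1983to89
open Literature.MathematicalPhysics.QuantumFieldTheory.Balaban1983to89.T4BetaStationary
open Literature.MathematicalPhysics.QuantumFieldTheory.Balaban1983to89.T4BetaFlowWellPosed
open Summit.QuantumFields.BalabanUV.Beta.EriceRemainderEnclosureHistoryAutonomyComparisonDefectInfiniteMemoryStep (const_mono step_both)

variable {B B' : (ℕ → ℝ) → ℝ} {M γ b : ℝ} {h' hlo hup : ℕ → ℝ}

/-- **INFINITE-MEMORY ENCLOSURE.**  `B`: isotone on the box `]0,γ]^ℕ`, zeroth moment `M`, floor `b`, `B ≤ β̄`; WINDOW PROFILES: for every `K`, `B u − B v ≤ Σ_{k<K} Λ_k·(1∕v_k² −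
1∕u_k²)⁺` whenever `u, v ∈ ]0,γ]^ℕ` have age-`k` levels `≥ 1∕γ² + (k+1)b₀` for `k < K` and AGREE from coordinate `K` on (`Λ ≥ 0`; `0 < b₀`, `b₀ + ε < b`), with partial age
moments `Σ_{k<K} k·Λ_k ≤ θ < 1` and `Σ_{k<K} Λ_k·Σ_{l<k}(l+1) ≤ θ₂` for ALL `K`; FADING TAILS: `|B u − B v| ≤ η_K` whenever `u, v` agree on the first `K` coordinates, with
`η_K → 0`.  `B′`: ANY functional with `|B′ u − B u| ≤ ε` on the box (`ε ≥ 0`).  `h₋, h₊, h′`: ANY box solutions of `B − ε`, `B + ε`, `B′` from one pin `p`.  Then at EVERY scale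
`j`:  **`1∕h₋_j² − θ₂·(2ε + θ·2ε∕(1−θ)) ≤ 1∕h′_j² ≤ 1∕h₊_j² + θ₂·(2ε + θ·2ε∕(1−θ))`** — the constant of (E140l), now for infinite memory. [folklore] -/
theorem enclosure_infinite {Λ : ℕ → ℝ} {η : ℕ → ℝ} {βb p ε b₀ θ θ₂ : ℝ}
    (hmono : ∀ u v : ℕ → ℝ, SeqBox γ u → SeqBox γ v → (∀ i, u i ≤ v i) → B u ≤ B v)
    (hB : ∀ u u' : ℕ → ℝ, SeqBox γ u → SeqBox γ u' → ∀ D : ℝ, (∀ j, |u j - u' j| ≤ D) → |B u - B u'| ≤ M * D) (hM : 0 ≤ M)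
    (hε : 0 ≤ ε) (hb₀ : 0 < b₀) (hfit : b₀ + ε < b)
    (hlow : ∀ u, SeqBox γ u → b ≤ B u) (hbdd : ∀ u, SeqBox γ u → B u ≤ βb)
    (hΛ : ∀ k, 0 ≤ Λ k) (hS1 : ∀ K : ℕ, ∑ k ∈ range K, (k : ℝ) * Λ k ≤ θ) (hθ1 : θ < 1)
    (hS2 : ∀ K : ℕ, ∑ k ∈ range K, Λ k * ∑ l ∈ range k, ((l : ℝ) + 1) ≤ θ₂)
    (hwin : ∀ K : ℕ, ∀ u v : ℕ → ℝ, SeqBox γ u → SeqBox γ v → (∀ k : ℕ, k < K → 1 / γ ^ 2 + ((k : ℝ) + 1) * b₀ ≤ 1 / u k ^ 2) →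
      (∀ k : ℕ, k < K → 1 / γ ^ 2 + ((k : ℝ) + 1) * b₀ ≤ 1 / v k ^ 2) → (∀ k : ℕ, K ≤ k → u k = v k) →
      B u - B v ≤ ∑ k ∈ range K, Λ k * max (1 / v k ^ 2 - 1 / u k ^ 2) 0)
    (htail : ∀ K : ℕ, ∀ u v : ℕ → ℝ, SeqBox γ u → SeqBox γ v → (∀ k : ℕ, k < K → u k = v k) → |B u - B v| ≤ η K)
    (hηlim : Tendsto η atTop (𝓝 0))
    (hpert : ∀ u, SeqBox γ u → |B' u - B u| ≤ ε)
    (hp : 0 < p) (hpγ : p ≤ γ) (hhlo : SeqBox γ hlo) (hflo : MemFlow (fun w => B w + -ε) p hlo)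
    (hhup : SeqBox γ hup) (hfup : MemFlow (fun w => B w + ε) p hup) (hh' : SeqBox γ h') (hf' : MemFlow B' p h') (j : ℕ) :
    1 / hlo j ^ 2 - θ₂ * (2 * ε + θ * (2 * ε) / (1 - θ)) ≤ 1 / h' j ^ 2
      ∧ 1 / h' j ^ 2 ≤ 1 / hup j ^ 2 + θ₂ * (2 * ε + θ * (2 * ε) / (1 - θ)) := by
  -- nonnegativity of the tails and of the partial moments
  have hcst : SeqBox γ (fun _ => p) := fun _ => ⟨hp, hpγ⟩
  have hη0 : ∀ K, 0 ≤ η K := fun K => by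
    have := htail K _ _ hcst hcst (fun k _ => rfl)
    rw [sub_self, abs_zero] at this
    exact this
  have hS10 : ∀ K, 0 ≤ ∑ k ∈ range K, (k : ℝ) * Λ k := fun K => sum_nonneg fun k _ => mul_nonneg (Nat.cast_nonneg k) (hΛ k)
  have hS20 : ∀ K, 0 ≤ ∑ k ∈ range K, Λ k * ∑ l ∈ range k, ((l : ℝ) + 1) :=
    fun K => sum_nonneg fun k _ => mul_nonneg (hΛ k) (sum_nonneg fun l _ => by positivity)
  -- the linear constant κ
  set κ : ℝ := θ₂ * (2 + θ * 2 / (1 - θ)) with hκ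
  have hCκ : ∀ x : ℝ, θ₂ * (2 * x + θ * (2 * x) / (1 - θ)) = κ * x := fun x => by rw [hκ]; ring
  -- the estimate at every admissible truncation level
  have hstep : ∀ K, η K ≤ b - b₀ - ε →
      1 / hlo j ^ 2 - ((2 * (j : ℝ) + 2 * κ) * η K + κ * ε) ≤ 1 / h' j ^ 2
        ∧ 1 / h' j ^ 2 ≤ 1 / hup j ^ 2 + ((2 * (j : ℝ) + 2 * κ) * η K + κ * ε) := by
    intro K hK
    have hS1K : ∑ k ∈ range K, (k : ℝ) * Λ k < 1 := (hS1 K).trans_lt hθ1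
    have hs := step_both hmono hB hM hε hb₀ (hη0 K) (by linarith) hlow hbdd hΛ hS1K (hwin K) (htail K) hpert hp hpγ
      hhlo hflo hhup hfup hh' hf' j
    have hc1 := const_mono (hS10 K) (hS1 K) hθ1 (hS20 K) (hS2 K) (hη0 K)
    have hc2 := const_mono (hS10 K) (hS1 K) hθ1 (hS20 K) (hS2 K) (by linarith [hη0 K] : 0 ≤ ε + η K)
    rw [hCκ] at hc1 hc2
    have e : (2 * (j : ℝ) + 2 * κ) * η K + κ * ε = 2 * (j : ℝ) * η K + κ * η K + κ * (ε + η K) := by ring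
    rw [e]
    obtain ⟨hs1, hs2⟩ := hs
    constructor
    · linarith
    · linarith
  -- eventually every K is admissible
  have hδ : (0 : ℝ) < b - b₀ - ε := by linarith
  have hev : ∀ᶠ K in atTop, η K ≤ b - b₀ - ε :=
    (hηlim.eventually (Iio_mem_nhds hδ)).mono fun K hK => le_of_lt hK
  -- the limit K → ∞
  have hlim : Tendsto (fun K => (2 * (j : ℝ) + 2 * κ) * η K + κ * ε) atTop (𝓝 ((2 * (j : ℝ) + 2 * κ) * 0 + κ * ε)) :=
    (hηlim.const_mul _).add tendsto_const_nhds
  rw [mul_zero, zero_add] at hlim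
  have hκε : κ * ε = θ₂ * (2 * ε + θ * (2 * ε) / (1 - θ)) := (hCκ ε).symm
  constructor
  · have hl : Tendsto (fun K => 1 / hlo j ^ 2 - ((2 * (j : ℝ) + 2 * κ) * η K + κ * ε)) atTop (𝓝 (1 / hlo j ^ 2 - κ * ε)) :=
      tendsto_const_nhds.sub hlim
    have := le_of_tendsto hl (hev.mono fun K hK => (hstep K hK).1)
    rwa [hκε] at this
  · have hl : Tendsto (fun K => 1 / hup j ^ 2 + ((2 * (j : ℝ) + 2 * κ) * η K + κ * ε)) atTop (𝓝 (1 / hup j ^ 2 + κ * ε)) :=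
      tendsto_const_nhds.add hlim
    have := ge_of_tendsto hl (hev.mono fun K hK => (hstep K hK).2)
    rwa [hκε] at this

end Summit.QuantumFields.BalabanUV.Beta.EriceRemainderEnclosureHistoryAutonomyComparisonDefectInfiniteMemory

end
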